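import Summits.HodgeConjecture.HodgeConjecture.Theorems.K2E3WittLeviCartanLabels
import HarnessLib

/-!
# Levi Cartan decomposition of `U(σ, J₀)` for ANY isometric involution, modulo the Cartan decomposition of the quasi-split groups `U(σ, J₀^{(N′)})`
# themselves (the letter `hbase`): the recursion over the first `GL` block (crux H413, 13a road A′, wild quasi-split places)

Cell `hodgecm-mathlib`, Track B, line `K2_E3_EllipticInputs`, 13a road A; seat K2E3-p10 (g3) (line lead).  THEOREMS ONLY; count-neutral helper.

★ `K2E3WittLeviCartanRecursion.exists_leviIntegral_mul_zpowDiagGL_mul` (p856389) proves, under ★ `UnramifiedLocalConjDatum σ ϖ`, that every element of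
`U(σ, J₀) ∩ M_S` is `k₁ · diag(ϖ^E) · k₂` with `k₁, k₂ ∈ U ∩ GL_N(𝒪) ∩ M_S` and `E` antitone on the `S`-blocks, `E ∘ rev = −E` — by strong induction on the
Witt index, the unramified datum entering ONLY through the base case `S = univ` (★ `heckeCosetMk_zpowDiagGL_eq_of_unitary`, the Cartan decomposition of the
quasi-split group at an UNRAMIFIED place) and through the letters `σσ = 1`, `|σ ·| = |·|`, `σ ϖ = ϖ`, `|ϖ| = q⁻¹`.  THIS FILE runs the same recursion with the
base case as a LETTER `hbase` — the Cartan decomposition `U(σ, J₀^{(N′)}) = K₀ · diag(ϖ^a) · K₀` (`a` antitone, `a ∘ rev = −a`) for every `N′` — and bare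
binders `hσ hvσ hϖ hσϖ`, so that it serves EVERY quasi-split place: at the unramified ones `hbase` is ★, at the tamely ramified ones it is ★ K2E3-p09
(`K2E3WittCartanTameRamified`), and at the WILDLY ramified ones it is K2E3-p09 (g3)'s «Cartan for any involution» (`K2E3QuasiSplitUnitaryCartanAnyInvolutionStep`
and its sequel), whose target shape is exactly `hbase` below.

* **`exists_leviIntegral_mul_zpowDiagGL_mul_of_base`** — `hbase ⟹` the Levi Cartan decomposition in diagonal form for every `S ⊆ Fin r` (`m ≤ 1`, standard `e`).

The sequel `K2E3WittLeviCartanOfBase` rewrites `diag(ϖ^E)` in the frozen `hcartanLevi(S)` shape (cone × centre), as ★ `K2E3WittLeviCartanUnramified` does.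

References: F. Bruhat, J. Tits (1972), (4.4.3); J. Tits (1979), §3.3.3; I. N. Bernstein, A. V. Zelevinsky (1977), §2.1; I. G. Macdonald (1995), Ch. V §2.
-/

set_option autoImplicit false
set_option linter.dupNamespace false

noncomputable section

open scoped Valued WithZero Matrix MatrixGroups
open Matrix

namespace Summit.HodgeConjecture.HodgeConjecture.Cruxes.H413.K2E3WittLeviCartanRecursionOfBase

open Literature.NumberTheory.Automorphic Literature.NumberTheory.Automorphic.HermitianLattice
open Literature.NumberTheory.Automorphic.CartanUnique
open K2E3LocalUnitaryWitt K2E3WittLeviCartanBlocks K2E3WittCartanUnramified K2E3WittLeviCartanLabels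

/-! ## §2 The recursion -/

section Recursion

variable {K : Type*} [Field K] [Valued K ℤᵐ⁰] [IsPrincipalIdealRing (Valued.v (R := K)).valuationSubring] {σ : K →+* K} {ϖ : K}

/-- **LEVI CARTAN DECOMPOSITION, diagonal form, from the base Cartan letter**: for `W = J₀` in a standard indexing `e : WittIndex r m ≃ Fin N` (`m ≤ 1`),
`σ` an involution with `|σ a| = |a|`, `ϖ` a `σ`-fixed uniformiser, and `hbase` = the Cartan decomposition of `U(σ, J₀^{(N′)})` for every `N′`
(`g = k₁ · diag(ϖ^a) · k₂`, `k₁, k₂ ∈ K₀`, `a` antitone with `a ∘ rev = −a`): for every `S ⊆ Fin r`, every `g ∈ U(σ, J₀) ∩ M_S` is `k₁ · diag(ϖ^E) · k₂` with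
`k₁, k₂ ∈ U ∩ GL_N(𝒪) ∩ M_S` and `E : Fin N → ℤ` antitone on each `S`-block, `E ∘ rev = −E` (principal valuation ring).  Strong induction on `r`, peeling
the first `GL` block, verbatim ★ p856389 with the base case replaced by the letter.
[cite: BruhatTits1972, (4.4.3)] [cite: Tits1979, §3.3.3] [cite: Macdonald1995, Ch. V §2 (2.2)] -/
theorem exists_leviIntegral_mul_zpowDiagGL_mul_of_base (hσ : ∀ a, σ (σ a) = a) (hvσ : ∀ a, Valued.v (σ a) = Valued.v a)
    (hϖ : Valued.v ϖ = WithZero.exp (-1 : ℤ)) (hσϖ : σ ϖ = ϖ)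
    (hbase : ∀ (N' : ℕ) (g : unitaryGroupOfForm σ ((StdForm.antidiagonal N').over K)),
      ∃ k₁ k₂ : unitaryGroupOfForm σ ((StdForm.antidiagonal N').over K),
        k₁ ∈ unitaryInt σ ((StdForm.antidiagonal N').over K) ∧ k₂ ∈ unitaryInt σ ((StdForm.antidiagonal N').over K) ∧
        ∃ a : Fin N' → ℤ, (∀ i j : Fin N', i ≤ j → a j ≤ a i) ∧ (∀ i, a (Fin.rev i) = -a i) ∧
          (g : GL (Fin N') K) = k₁ * zpowDiagGL (uniformizer_ne_zero hϖ) a * k₂) :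
    ∀ (r : ℕ) {m N : ℕ} (_hm : m ≤ 1) (e : WittIndex r m ≃ Fin N)
      (_hstd : ∀ x, (e x).val = Sum.elim (fun i : Fin r => i.val) (Sum.elim (fun u : Fin m => r + u.val) (fun j : Fin r => r + m + j.val)) x)
      (S : Finset (Fin r)) (g : unitaryGroupOfForm σ ((StdForm.antidiagonal N).over K))
      (_hgL : (g : GL (Fin N) K) ∈ standardLeviGL K (wittBlockOn e S)),
      ∃ k₁ k₂ : unitaryGroupOfForm σ ((StdForm.antidiagonal N).over K),
        k₁ ∈ unitaryInt σ ((StdForm.antidiagonal N).over K) ∧ (k₁ : GL (Fin N) K) ∈ standardLeviGL K (wittBlockOn e S) ∧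
        k₂ ∈ unitaryInt σ ((StdForm.antidiagonal N).over K) ∧ (k₂ : GL (Fin N) K) ∈ standardLeviGL K (wittBlockOn e S) ∧
        ∃ E : Fin N → ℤ, (∀ i j : Fin N, wittBlockOn e S i = wittBlockOn e S j → i ≤ j → E j ≤ E i) ∧ (∀ i, E (Fin.rev i) = -E i) ∧
          (g : GL (Fin N) K) = k₁ * zpowDiagGL (uniformizer_ne_zero hϖ) E * k₂ := by
  have hϖ0 : ϖ ≠ 0 := uniformizer_ne_zero hϖ
  intro r
  induction r using Nat.strong_induction_on with
  | _ r IH =>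
  intro m N hm e hstd S g hgL
  have hN : N = r + (m + r) := by simpa using (Fintype.card_congr e).symm
  by_cases hS : Finset.univ \ S = ∅
  · -- `S = univ`: the Cartan decomposition of `U` itself
    have hSu : S = Finset.univ := Finset.univ_subset_iff.1 (Finset.sdiff_eq_empty_iff_subset.1 hS)
    subst hSu
    have hlab : ∀ i j : Fin N, wittBlockOn e (Finset.univ : Finset (Fin r)) i = wittBlockOn e Finset.univ j := fun i j => by
      rw [wittBlockOn_apply, wittBlockOn_apply, wittBlock_univ, wittBlock_univ]
    obtain ⟨k₁, k₂, hk₁, hk₂, a, hanti, hrev, hgk⟩ := hbase N g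
    exact ⟨k₁, k₂, hk₁, (mem_standardLeviGL_iff _ _).2 fun i j hij => absurd (hlab i j) hij, hk₂,
      (mem_standardLeviGL_iff _ _).2 fun i j hij => absurd (hlab i j) hij, a, fun i j _ hij => hanti i j hij, hrev, hgk⟩
  · -- the first break `α₀`, `c = α₀ + 1`
    have hne : (Finset.univ \ S).Nonempty := Finset.nonempty_iff_ne_empty.2 hS
    obtain ⟨α₀, hα₀mem, hα₀min⟩ : ∃ α₀ ∈ Finset.univ \ S, ∀ α ∈ Finset.univ \ S, α₀ ≤ α :=
      ⟨(Finset.univ \ S).min' hne, Finset.min'_mem _ hne, fun α hα => Finset.min'_le _ _ hα⟩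
    have hα₀ : α₀ ∉ S := (Finset.mem_sdiff.1 hα₀mem).2
    have hmin : ∀ α, α ∉ S → α₀ ≤ α := fun α hα => hα₀min α (Finset.mem_sdiff.2 ⟨Finset.mem_univ _, hα⟩)
    have hα₀r := α₀.isLt
    have hc : 2 * (α₀.val + 1) ≤ N := by omega
    have hN' : (r - (α₀.val + 1)) + (m + (r - (α₀.val + 1))) = N - 2 * (α₀.val + 1) := by omega
    have hr' : r - (α₀.val + 1) < r := by omega
    -- `g ∈ Q_c`, block diagonal
    have hgP : g ∈ blockParabolic σ N (α₀.val + 1) := mem_blockParabolic_of_mem_standardLeviGL e hstd hm hα₀ hmin hgL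
    have hgP' := mem_standardParabolicGL_toDual_of_mem_standardLeviGL e hstd hm hα₀ hmin hgL
    -- the first block
    obtain ⟨κ₁, κ₂, hκ₁, hκ₂, lam, hlam, hA⟩ := exists_integral_mul_zpowDiagGL_antitone_mul hϖ (loBlockGL hc ⟨g, hgP⟩)
    -- the middle block, by induction on the shifted datum
    have hg'L := coe_midBlockU_mem_standardLeviGL e hstd hα₀ hmin hc hN' hgL hgP
    obtain ⟨κ₁', κ₂', hκ₁', hκ₁'L, hκ₂', hκ₂'L, E', hE'anti, hE'rev, hg'⟩ :=
      IH _ hr' hm (stdWittEquivFin (r - (α₀.val + 1)) m hN') (stdWittEquivFin_hstd (r - (α₀.val + 1)) m hN')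
        (Finset.univ.filter fun α' : Fin (r - (α₀.val + 1)) => (⟨α'.val + (α₀.val + 1), by have := α'.isLt; omega⟩ : Fin r) ∈ S)
        (midBlockU hc ⟨g, hgP⟩) hg'L
    -- the glued exponent function
    obtain ⟨E, hE⟩ : ∃ E : Fin N → ℤ, E = fun p => if h0 : p.val < α₀.val + 1 then lam ⟨p.val, h0⟩
        else if h1 : p.val + (α₀.val + 1) < N then E' ⟨p.val - (α₀.val + 1), by omega⟩ else -lam ⟨N - 1 - p.val, by omega⟩ := ⟨_, rfl⟩
    have hElo : ∀ i : Fin (α₀.val + 1), E (Fin.castLE (le_of_two_mul_le hc) i) = lam i := fun i => by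
      rw [hE]; dsimp only; rw [dif_pos (by exact i.isLt)]
      exact congrArg lam (Fin.ext rfl)
    have hEmid : ∀ j : Fin (N - 2 * (α₀.val + 1)), E (midIndex hc j) = E' j := fun j => by
      have hj := j.isLt
      have h1 : ¬ ((midIndex hc j).val < α₀.val + 1) := by rw [coe_midIndex]; omega
      have h2 : (midIndex hc j).val + (α₀.val + 1) < N := by rw [coe_midIndex]; omega
      rw [hE]; dsimp only; rw [dif_neg h1, dif_pos h2]
      congr 1; apply Fin.ext; change (midIndex hc j).val - (α₀.val + 1) = j.val; rw [coe_midIndex]; omega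
    have hEhi : ∀ i : Fin (α₀.val + 1), E (hiIndex hc i) = -lam (Fin.rev i) := fun i => by
      have hi := i.isLt
      have h1 : ¬ ((hiIndex hc i).val < α₀.val + 1) := by rw [coe_hiIndex]; omega
      have h2 : ¬ ((hiIndex hc i).val + (α₀.val + 1) < N) := by rw [coe_hiIndex]; omega
      rw [hE]; dsimp only; rw [dif_neg h1, dif_neg h2]
      congr 2; apply Fin.ext; change N - 1 - (hiIndex hc i).val = (Fin.rev i).val; rw [Fin.val_rev, coe_hiIndex]; omega
    have hErev : ∀ p, E (Fin.rev p) = -E p := by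
      intro p
      obtain ⟨x, rfl⟩ := (blockSum hc).surjective p
      rcases x with (i | i) | i
      · rw [blockSum_inl_inl, rev_castLE hc, hEhi, Fin.rev_rev, hElo]
      · rw [blockSum_inl_inr, rev_midIndex hc, hEmid, hEmid, hE'rev]
      · rw [blockSum_inr, rev_hiIndex hc, hElo, hEhi, neg_neg]
    have hEanti : ∀ i j : Fin N, wittBlockOn e S i = wittBlockOn e S j → i ≤ j → E j ≤ E i := by
      intro p q hlab hpq
      have hb := blockLabel_eq_of_wittBlockOn_eq e hstd hm hα₀ hmin hlab
      obtain ⟨x, rfl⟩ := (blockSum hc).surjective p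
      obtain ⟨y, rfl⟩ := (blockSum hc).surjective q
      rcases x with (i | i) | i <;> rcases y with (j | j) | j <;>
        simp only [blockSum_inl_inl, blockSum_inl_inr, blockSum_inr, blockLabel_castLE hc, blockLabel_midIndex hc, blockLabel_hiIndex hc] at hb
      all_goals first
        | exact absurd hb (by decide)
        | skip
      · rw [blockSum_inl_inl] at hpq ⊢; rw [blockSum_inl_inl] at hpq ⊢
        rw [hElo, hElo]
        exact hlam ((Fin.castLE_le_castLE_iff _).1 hpq)
      · rw [blockSum_inl_inr] at hlab hpq ⊢; rw [blockSum_inl_inr] at hlab hpq ⊢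
        rw [hEmid, hEmid]
        refine hE'anti i j (Fin.ext ?_) (Fin.le_iff_val_le_val.2 ?_)
        · have h' := congrArg Fin.val hlab
          rw [wittBlockOn_apply, wittBlockOn_apply, wittBlock_val, wittBlock_val, wittBlockNat_symm_midIndex e hstd hα₀ hmin hc hN',
            wittBlockNat_symm_midIndex e hstd hα₀ hmin hc hN'] at h'
          rw [wittBlockOn_apply, wittBlockOn_apply, wittBlock_val, wittBlock_val]
          omega
        · rw [Fin.le_iff_val_le_val, coe_midIndex, coe_midIndex] at hpq; omega
      · rw [blockSum_inr] at hpq ⊢; rw [blockSum_inr] at hpq ⊢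
        rw [hEhi, hEhi, neg_le_neg_iff]
        refine hlam (Fin.rev_le_rev.2 (Fin.le_iff_val_le_val.2 ?_))
        rw [Fin.le_iff_val_le_val, coe_hiIndex, coe_hiIndex] at hpq; omega
    -- the three factors `k₁ = diag(κ₁, κ₁′, κ₁†)`, `D = diag(ϖ^E)`, `k₂ = diag(κ₂, κ₂′, κ₂†)`
    have hk₁P : blockDiagLift hσ hc κ₁ κ₁' ∈ blockParabolic σ N (α₀.val + 1) := blockDiagLift_mem_blockParabolic hσ hc κ₁ κ₁'
    have hk₂P : blockDiagLift hσ hc κ₂ κ₂' ∈ blockParabolic σ N (α₀.val + 1) := blockDiagLift_mem_blockParabolic hσ hc κ₂ κ₂'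
    have hDP : (⟨zpowDiagGL hϖ0 E, zpowDiagGL_mem_unitaryGroupOfForm hσϖ _ hErev⟩ :
        unitaryGroupOfForm σ ((StdForm.antidiagonal N).over K)) ∈ blockParabolic σ N (α₀.val + 1) :=
      zpowDiagGL_mem_blockParabolic hσϖ hϖ0 hc hErev
    -- the product `k₁ D k₂` inside `Q_c`
    have hprodP' : ((((⟨blockDiagLift hσ hc κ₁ κ₁', hk₁P⟩ : blockParabolic σ N (α₀.val + 1)) *
        ⟨⟨zpowDiagGL hϖ0 E, zpowDiagGL_mem_unitaryGroupOfForm hσϖ _ hErev⟩, hDP⟩ * ⟨blockDiagLift hσ hc κ₂ κ₂', hk₂P⟩ :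
          blockParabolic σ N (α₀.val + 1)) : unitaryGroupOfForm σ ((StdForm.antidiagonal N).over K)) : GL (Fin N) K) ∈
        standardParabolicGL K (OrderDual.toDual ∘ blockLabel N (α₀.val + 1)) := by
      rw [Subgroup.coe_mul, Subgroup.coe_mul, Subgroup.coe_mul, Subgroup.coe_mul]
      exact Subgroup.mul_mem _ (Subgroup.mul_mem _ (coe_blockDiagLift_mem_standardParabolicGL_toDual hσ hc κ₁ κ₁')
        (zpowDiagGL_mem_standardParabolicGL _ hϖ0 E)) (coe_blockDiagLift_mem_standardParabolicGL_toDual hσ hc κ₂ κ₂')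
    have hlamE : zpowDiagGL (uniformizer_ne_zero hϖ) lam = zpowDiagGL hϖ0 (E ∘ Fin.castLE (le_of_two_mul_le hc)) := by
      rw [show lam = E ∘ Fin.castLE (le_of_two_mul_le hc) from (funext hElo).symm]
    -- the equation, by rigidity
    have heq : g = (((⟨blockDiagLift hσ hc κ₁ κ₁', hk₁P⟩ : blockParabolic σ N (α₀.val + 1)) *
        ⟨⟨zpowDiagGL hϖ0 E, zpowDiagGL_mem_unitaryGroupOfForm hσϖ _ hErev⟩, hDP⟩ * ⟨blockDiagLift hσ hc κ₂ κ₂', hk₂P⟩ :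
          blockParabolic σ N (α₀.val + 1)) : unitaryGroupOfForm σ ((StdForm.antidiagonal N).over K)) := by
      refine eq_of_loBlockGL_eq_of_midBlockU_eq hc hgP hgP' (Subtype.prop _) hprodP' ?_ ?_
      · change loBlockGL hc ⟨g, hgP⟩ = loBlockGL hc ((⟨blockDiagLift hσ hc κ₁ κ₁', hk₁P⟩ : blockParabolic σ N (α₀.val + 1)) *
          ⟨⟨zpowDiagGL hϖ0 E, zpowDiagGL_mem_unitaryGroupOfForm hσϖ _ hErev⟩, hDP⟩ * ⟨blockDiagLift hσ hc κ₂ κ₂', hk₂P⟩)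
        rw [map_mul, map_mul, loBlockGL_blockDiagLift, loBlockGL_blockDiagLift, loBlockGL_zpowDiagGL hσϖ hϖ0 hc hErev, hA, hlamE]
      · change midBlockU hc ⟨g, hgP⟩ = midBlockU hc ((⟨blockDiagLift hσ hc κ₁ κ₁', hk₁P⟩ : blockParabolic σ N (α₀.val + 1)) *
          ⟨⟨zpowDiagGL hϖ0 E, zpowDiagGL_mem_unitaryGroupOfForm hσϖ _ hErev⟩, hDP⟩ * ⟨blockDiagLift hσ hc κ₂ κ₂', hk₂P⟩)
        rw [map_mul, map_mul, midBlockU_blockDiagLift, midBlockU_blockDiagLift]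
        refine Subtype.ext ?_
        rw [hg', Subgroup.coe_mul, Subgroup.coe_mul]
        congr 2
        refine Units.ext ?_
        rw [coe_zpowDiagGL, coe_midBlockU_zpowDiagGL hσϖ hϖ0 hc hErev]
        congr 1
        funext j
        rw [hEmid]
    refine ⟨_, _, blockDiagLift_mem_unitaryInt hσ hvσ hc hκ₁.1 hκ₁.2.1 hκ₁',
      coe_blockDiagLift_mem_standardLeviGL e hstd hm hα₀ hmin hσ hc hN' κ₁ hκ₁'L,
      blockDiagLift_mem_unitaryInt hσ hvσ hc hκ₂.1 hκ₂.2.1 hκ₂',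
      coe_blockDiagLift_mem_standardLeviGL e hstd hm hα₀ hmin hσ hc hN' κ₂ hκ₂'L, E, hEanti, hErev, ?_⟩
    have h := congrArg (fun x : unitaryGroupOfForm σ ((StdForm.antidiagonal N).over K) => (x : GL (Fin N) K)) heq
    simp only [Subgroup.coe_mul] at h
    exact h

end Recursion

end Summit.HodgeConjecture.HodgeConjecture.Cruxes.H413.K2E3WittLeviCartanRecursionOfBase

end
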